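import Literature.MathematicalPhysics.QuantumFieldTheory.Balaban1983to89.B9Thm314WholeCancellationLayer
import Literature.MathematicalPhysics.QuantumFieldTheory.Balaban1983to89.B9Thm315WholeSectERepOn
import Literature.MathematicalPhysics.QuantumFieldTheory.Balaban1983to89.B9BackgroundsKLevelV1R

/-!
# `Balaban1983to89.B9Thm314Thm315LayerR` — [B9] Theorem 3.14 (rows 22–23, the pair ∕ cancellation reading at NODE 00's layer of letters) and
# Theorem 3.15 (row 24, through the (3.185) slot at the Sect. E layer, middle decay on Λ) RE-PRESSED ONCE at def-Y's CLASS-PARAMETRIC carrier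
# `bg9YR R₁ R₂` (dag-lead CASCADE-R): the edition-8 leaves `t314`, `t314loc`, `t315` of `B9PinCarriersKLevelV1R.b9LeafX_carriersYR`

T. Bałaban, *Propagators for lattice gauge theories in a background field*, Commun. Math. Phys. **99** (1985) 389–434
[`Balaban1985BackgroundPropagators`, "B9"].
pub-ymgap Track A, node N06 = `Dag.B9_main`; seat `pub-ymgap-dag-n06-f` g14 (an idle N06 seat taking the CASCADE-R twin of dag-n06-m's two consumed faces,
dag-lead GO-CASCADE-R «an owner-less file goes to the first idle N06 seat»); plan of record: node00-def-Y LOCATED-CASCADE-P + FILE 18a `B9BackgroundsKLevelV1R`.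

statement-level skeleton of published theorems with citation tags; proofs where landed; nothing here is a claim about the
Yang–Mills mass gap

THE PRINTED LOCUS.  Thm 3.14 (3.154) pp. 426–427 (proof p. 427: *"We take random walk expansions for both operators …"*); Thm 3.15 (3.185)–(3.187)
p. 432; the regularity classes (3.35)–(3.36) p. 396, which both theorems take as HYPOTHESES on the configuration `U`.

THE POINT.  def-Y's MODULE 3-R makes the regularity predicates of the member carrier PARAMETERS `R₁ R₂ : RegFamY …` (`bg9YR 𝔸 G R₁ R₂ x`: configurations,
`1`, product, (3.37)–(3.38) verbatim; `Reg335 := R₁ x`, `Reg336 := R₂ x`), and re-types the kernel records fieldwise (`kernelFamilyR`, `siteKernelR`, all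
entries `rfl`).  dag-n06-m's two landed faces that the N06 certificate CONSUMES (edition 7 `…N06AtOpsYNuOfRecordV6EPairMT` :254, :259),

  `B9Thm314WholeCancellationLayer.thm314_pair_layerOfLetters` — rows 22–23 `Thm314Printed ∧ Thm314LocalPrinted` for `(operatorLayerYOfLetters …).Kdiff`,
  `B9Thm315WholeSectERepOn.t315_opsYSectE_of_3185_on`      — row 24 `Thm315FullPrinted` at the Sect. E family `opsYSectE …`,

pin `bg9Y` as the backgrounds FAMILY of whole-lattice predicates that READ the class (as the premises `(bg x).Reg335 ∕ Reg336 c35 α₀ U`), so the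
certificate's edition 8 over `carriersYR … R₁ R₂` needs their R-TWINS: the same statements and the same proof terms with `bg9Y ↦ bg9YR 𝔸 G R₁ R₂`
(def-Y's recipe).  Both proofs go through dag-n06-m's CLASS-FREE generic layers — `B9Thm314WholePairWalks.thm314_pair_of_pair_walks`
(`{bg : I → Backgrounds} {Kdiff}`) with `B9Thm314WholeCancellationLayer.dominatedBySums_pair_kernelFamilyB` (`{B : Backgrounds} {cfg}`), and
`B9Thm315WholeSectERepOn.bound3187_sectE_of_3185_on` (one configuration, no class) — so nothing of dag-n06-m's is restated or re-proved:

* §1 (Thm 3.14) `kernelFamilyR_Kdiff_operatorLayerYOfLetters` (`rfl`: the re-typed `Kdiff` member IS def-Y's reading `kernelFamilyB` over `bg9YR`),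
  `hdom_layerOfLettersR` (the knit's domination reading over `bg9YR`), ★★★ `thm314_pair_layerOfLettersR` (rows 22–23 over `bg9YR 𝔸 G R₁ R₂`, dag-n06-m's
  binders verbatim but typed over `bg9YR`), `thm314_pair_layerOfLettersR_regY_iff` (at MODULE 3's families the re-pressed rows ARE the landed ones, `Iff.rfl`).
* §2 (Thm 3.15) `siteKernelR_Ck_operatorLayerYSectE` (`rfl`), ★★ `thm315FullPrinted_sectE_of_3185_onR` (layer level, every `𝔸 G ops 𝔏 𝔢 𝔴 R₁ R₂`; the class
  enters only as the two displayed premises `(bg9YR … x).Reg335 ∕ Reg336 c35Y α₀ U`, i.e. `R₁ ∕ R₂ x c35Y α₀ U` — def-Y's `bg9YR_reg335_iff`),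
  ★★★ `t315_opsYSectE_of_3185_onR` (record level, `G = SU(N)`: edition 7's :254 call with `bg9Y ↦ bg9YR`), `t315_opsYSectE_of_3185_onR_regY_iff` (`Iff.rfl`).

HONEST SCOPE.  Kernel re-typing bookkeeping over dag-n06-m's LANDED faces (same mathematics, same proof terms); the Theorem-3.10 all-norms leaves `h₁ h₂`,
the located approximation identity `hexp`, the (3.185) identity, the expansion clause, the outer locality and the Λ-restricted middle decay stay DISPLAYED
exactly as in dag-n06-m's files; nothing of [B9] newly asserted; count-neutral; N06 NOT discharged; ONE finite-torus programme at fixed ε, Bałaban as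
printed; nothing continuum ∕ ℝ⁴ ∕ OS ∕ mass-gap ∕ Clay.  NOT HERE: dag-n06-m's `thm314_pair_opsYOfRecordDE` ∕ `t315_opsYOfRecordDE_of_slots` (opened but
not consumed by any edition since 5 — no twin owed), the other CASCADE-R twins (n06-h rows 11–12, n06-i (3.132), n06-j Thm 3.9∕3.11, n06-c Summits side),
edition 8 itself (dag-n06-d).
-/

noncomputable section

namespace Literature.MathematicalPhysics.QuantumFieldTheory.Balaban1983to89.B9Thm314Thm315LayerR

open B9PinMembersKLevelV1 (MemberY geo9Y bg9Y)
open B9PinCarriersKLevelV1 (OperatorLayerY)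
open B9BackgroundsKLevelV1R (RegFamY bg9YR regY335 regY336 kernelFamilyR siteKernelR)
open B9 B9Thm314 Node00
open B9Thm314WholeExpansionReads (ExpansionReads)
open B9Thm314WholeSummation (DominatedBySums WalkSetsSpec WalkWeightsSummable)
open B9Thm314WholePair (pairExpansion pairTermK locData₂)
open B9Thm314WholePairWalks (pairWalkSets thm314_pair_of_pair_walks)
open B9Thm314WholeCancellationLayer (pairOp dominatedBySums_pair_kernelFamilyB)
open B9SectCWalkTermsAllNorms B9FromB6ModelSignsOn
open B9PinGeometryKLevelV1 (inΛY unitDistY c35Y)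
open B9Thm315WholeSectERep (LocalOuterY)
open B9Thm315WholeSectERepOn (DecayMidOnY bound3187_sectE_of_3185_on)
open B7Prop2SpecialUnitary (specialUnitaryUnits)

variable {d ℓ : ℕ} {hd : 1 ≤ d + 1} {hL : Odd (ℓ + 1) ∧ 1 < ℓ + 1} {b₀ b₁ : ℝ} {Mstar : ℕ}
variable {𝔸 : Type} [NormedRing 𝔸] [NormedAlgebra ℂ 𝔸] [CompleteSpace 𝔸] {G : Subgroup 𝔸ˣ}

/-! ## §1 Theorem 3.14 (rows 22–23) at NODE 00's layer of letters over the class-parametric carrier -/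

section Thm314

variable (R₁ R₂ : RegFamY d ℓ hd hL b₀ b₁ Mstar 𝔸)

/-- the re-typed `Kdiff`-member of def-Y's layer of letters IS def-Y's bond-sector reading `kernelFamilyB` of the letter `𝔏.Kdiff` over `bg9YR R₁ R₂ x`
(same configurations, same transport letters; `rfl`). [cite: Balaban1985BackgroundPropagators, Thm 3.14 (3.154) p.426 (bookkeeping: the reading of G(Ω,U) − G(Ω′,U))] -/
theorem kernelFamilyR_Kdiff_operatorLayerYOfLetters (x : MemberY d ℓ hd hL b₀ b₁ Mstar) (𝔏 : CovLettersY 𝔸 x) (𝔈 : ExpLettersY 𝔸 G x) :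
    kernelFamilyR R₁ R₂ (operatorLayerYOfLetters 𝔸 G x 𝔏 𝔈).Kdiff =
      kernelFamilyB x.toKIdx (bg9YR 𝔸 G R₁ R₂ x) (fun U => U) 𝔏.Kdiff 𝔏.parB :=
  rfl

variable [FiniteDimensional ℂ 𝔸]

/-- ★ **THE KNIT's `hdom` AT THE LAYER OF LETTERS OVER `bg9YR R₁ R₂`**: at a member `x`, the domination reading of rows 22–23 for the re-typed
`kernelFamilyR R₁ R₂ (operatorLayerYOfLetters 𝔸 G x 𝔏 𝔈).Kdiff`, walk-term families pinned as the readings of the walk-term letters `T₁ T₂` over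
`bg9YR R₁ R₂ x`, from the located approximation identity `ExpansionReads` for `𝔏.Kdiff` — dag-n06-m's `dominatedBySums_pair_kernelFamilyB` (class-free).
[cite: Balaban1985BackgroundPropagators, Thm 3.14 proof p.427] -/
theorem hdom_layerOfLettersR (x : MemberY d ℓ hd hL b₀ b₁ Mstar) (𝔏 : CovLettersY 𝔸 x) (𝔈 : ExpLettersY 𝔸 G x)
    {E₁ E₂ : B9.RWExpansion (geo9Y x) (bg9YR 𝔸 G R₁ R₂ x)} (P₁ : E₁.Walk → Prop) (P₂ : E₂.Walk → Prop)
    (T₁ : E₁.Walk → BondOpY 𝔸 x.toKIdx) (T₂ : E₂.Walk → BondOpY 𝔸 x.toKIdx)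
    (W : ℕ → (geo9Y x).Site → (geo9Y x).Site → Finset (pairExpansion E₁ E₂ P₁ P₂).Walk) (U : (bg9YR 𝔸 G R₁ R₂ x).Cfg)
    (hR : ExpansionReads x.toKIdx (B := bg9YR 𝔸 G R₁ R₂ x) (fun U => U) 𝔏.Kdiff (pairOp P₁ P₂ T₁ T₂) W U) :
    DominatedBySums (pairExpansion E₁ E₂ P₁ P₂)
      (pairTermK E₁ E₂ P₁ P₂ (fun ω => kernelFamilyB x.toKIdx (bg9YR 𝔸 G R₁ R₂ x) (fun U => U) (T₁ ω) 𝔏.parB)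
        (fun ω => kernelFamilyB x.toKIdx (bg9YR 𝔸 G R₁ R₂ x) (fun U => U) (T₂ ω) 𝔏.parB))
      (kernelFamilyR R₁ R₂ (operatorLayerYOfLetters 𝔸 G x 𝔏 𝔈).Kdiff) W U :=
  dominatedBySums_pair_kernelFamilyB 𝔏.parB hR

/-- ★★★ **ROWS 22 AND 23 AT NODE 00's LAYER OF LETTERS OVER THE CLASS-PARAMETRIC CARRIER `bg9YR R₁ R₂`** — the edition-8 leaves `t314 ∧ t314loc` of
`B9PinCarriersKLevelV1R.b9LeafX_carriersYR` at any family whose `Kdiff` is the letters' (e.g. `opsYNuOfRecordV4E …` at `𝔏 := lettersYOfRecordV4 …`):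
dag-n06-m's `thm314_pair_layerOfLetters` with `bg9Y ↦ bg9YR 𝔸 G R₁ R₂` throughout (binders verbatim otherwise), by the class-free generic layer
`thm314_pair_of_pair_walks` with `hdom` supplied by `hdom_layerOfLettersR`.  Displayed, as there: the Theorem-3.10 all-norms leaves `h₁ h₂` about the readings
of the walk-term letters, the geometry and its laws, the M-uniform diameter bound, the model signs, the per-sequence walk sets and the located approximation
identity `hexp`.  Nothing of print asserted; NOT a node discharge. [cite: Balaban1985BackgroundPropagators, Thm 3.14 (3.154) pp.426–427] -/
theorem thm314_pair_layerOfLettersR (𝔏 : ∀ x : MemberY d ℓ hd hL b₀ b₁ Mstar, CovLettersY 𝔸 x)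
    (𝔈 : ∀ x : MemberY d ℓ hd hL b₀ b₁ Mstar, ExpLettersY 𝔸 G x) {c35 : ℝ}
    {OmK : ∀ x : MemberY d ℓ hd hL b₀ b₁ Mstar, (geo9Y x).Site → Prop}
    {dOmega : ∀ x : MemberY d ℓ hd hL b₀ b₁ Mstar, (geo9Y x).Site → (geo9Y x).Site → ℝ}
    {Ps : ∀ x : MemberY d ℓ hd hL b₀ b₁ Mstar, (geo9Y x).Loc → Prop}
    {E₁ E₂ : ∀ x : MemberY d ℓ hd hL b₀ b₁ Mstar, RWExpansion (geo9Y x) (bg9YR 𝔸 G R₁ R₂ x)}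
    (T₁ : ∀ x : MemberY d ℓ hd hL b₀ b₁ Mstar, (E₁ x).Walk → BondOpY 𝔸 x.toKIdx)
    (T₂ : ∀ x : MemberY d ℓ hd hL b₀ b₁ Mstar, (E₂ x).Walk → BondOpY 𝔸 x.toKIdx)
    (D₁ : ∀ x, LocData (geo9Y x) (bg9YR 𝔸 G R₁ R₂ x) (E₁ x))
    (X₂ : ∀ x, (E₂ x).Walk → ℕ → (geo9Y x).Site → Prop) (Meets₂ : ∀ x, (E₂ x).Walk → ℕ → Prop)
    (L₁ : ∀ x, (D₁ x).Laws (dOmega x)) (L₂ : ∀ x, (locData₂ (D₁ x) (X₂ x) (Meets₂ x)).Laws (dOmega x)) (r₀ : ℝ)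
    (hr : ∀ x, (D₁ x).diam ≤ r₀) (S : ∀ x, ModelSignsOn (geo9Y x) (Ps x)) (hdΩ : ∀ x (y y' : (geo9Y x).Site), 0 ≤ dOmega x y y')
    (h₁ : Thm310AllNormsPrinted c35 geo9Y (bg9YR 𝔸 G R₁ R₂) E₁
      (fun x ω => kernelFamilyB x.toKIdx (bg9YR 𝔸 G R₁ R₂ x) (fun U => U) (T₁ x ω) (𝔏 x).parB))
    (h₂ : Thm310AllNormsPrinted c35 geo9Y (bg9YR 𝔸 G R₁ R₂) E₂
      (fun x ω => kernelFamilyB x.toKIdx (bg9YR 𝔸 G R₁ R₂ x) (fun U => U) (T₂ x ω) (𝔏 x).parB))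
    (W₁ : ∀ x, ℕ → (geo9Y x).Site → (geo9Y x).Site → Finset (E₁ x).Walk)
    (W₂ : ∀ x, ℕ → (geo9Y x).Site → (geo9Y x).Site → Finset (E₂ x).Walk)
    (hW₁ : ∀ x, WalkSetsSpec (E₁ x) (W₁ x)) (hW₂ : ∀ x, WalkSetsSpec (E₂ x) (W₂ x))
    (hcnt₁ : WalkWeightsSummable geo9Y (bg9YR 𝔸 G R₁ R₂) E₁ W₁) (hcnt₂ : WalkWeightsSummable geo9Y (bg9YR 𝔸 G R₁ R₂) E₂ W₂)
    (hexp : ∀ (x : MemberY d ℓ hd hL b₀ b₁ Mstar) (U : (bg9YR 𝔸 G R₁ R₂ x).Cfg), (E₁ x).Converges U ∧ (E₂ x).Converges U →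
      ExpansionReads x.toKIdx (B := bg9YR 𝔸 G R₁ R₂ x) (fun U => U) (𝔏 x).Kdiff
        (pairOp (D₁ x).Touches (locData₂ (D₁ x) (X₂ x) (Meets₂ x)).Touches (T₁ x) (T₂ x))
        (pairWalkSets (W₁ x) (W₂ x) (D₁ x).Touches (locData₂ (D₁ x) (X₂ x) (Meets₂ x)).Touches) U) :
    Thm314Printed c35 geo9Y (bg9YR 𝔸 G R₁ R₂) (fun x => kernelFamilyR R₁ R₂ (operatorLayerYOfLetters 𝔸 G x (𝔏 x) (𝔈 x)).Kdiff) dOmega ∧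
      Thm314LocalPrinted c35 geo9Y (bg9YR 𝔸 G R₁ R₂) (fun x => kernelFamilyR R₁ R₂ (operatorLayerYOfLetters 𝔸 G x (𝔏 x) (𝔈 x)).Kdiff)
        OmK dOmega :=
  thm314_pair_of_pair_walks D₁ X₂ Meets₂ L₁ L₂ r₀ hr S hdΩ h₁ h₂ W₁ W₂ hW₁ hW₂ hcnt₁ hcnt₂
    fun x U hU => hdom_layerOfLettersR R₁ R₂ x (𝔏 x) (𝔈 x) _ _ (T₁ x) (T₂ x) _ U (hexp x U hU)

omit [FiniteDimensional ℂ 𝔸] in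
/-- at MODULE 3's families `(regY335, regY336)` the re-pressed rows 22–23 ARE dag-n06-m's landed statement (def-Y's `bg9Y_eq_bg9YR`, `kernelFamilyR_regY`,
both `rfl`). [cite: Balaban1985BackgroundPropagators, Thm 3.14 (3.154) p.426 (bookkeeping)] -/
theorem thm314_pair_layerOfLettersR_regY_iff (𝔏 : ∀ x : MemberY d ℓ hd hL b₀ b₁ Mstar, CovLettersY 𝔸 x)
    (𝔈 : ∀ x : MemberY d ℓ hd hL b₀ b₁ Mstar, ExpLettersY 𝔸 G x) (c35 : ℝ)
    (OmK : ∀ x : MemberY d ℓ hd hL b₀ b₁ Mstar, (geo9Y x).Site → Prop)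
    (dOmega : ∀ x : MemberY d ℓ hd hL b₀ b₁ Mstar, (geo9Y x).Site → (geo9Y x).Site → ℝ) :
    (Thm314Printed c35 geo9Y (bg9YR 𝔸 G (regY335 𝔸 G) (regY336 𝔸 G))
        (fun x => kernelFamilyR (regY335 𝔸 G) (regY336 𝔸 G) (operatorLayerYOfLetters 𝔸 G x (𝔏 x) (𝔈 x)).Kdiff) dOmega ∧
      Thm314LocalPrinted c35 geo9Y (bg9YR 𝔸 G (regY335 𝔸 G) (regY336 𝔸 G))
        (fun x => kernelFamilyR (regY335 𝔸 G) (regY336 𝔸 G) (operatorLayerYOfLetters 𝔸 G x (𝔏 x) (𝔈 x)).Kdiff) OmK dOmega) ↔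
    (Thm314Printed c35 geo9Y (bg9Y 𝔸 G) (fun x => (operatorLayerYOfLetters 𝔸 G x (𝔏 x) (𝔈 x)).Kdiff) dOmega ∧
      Thm314LocalPrinted c35 geo9Y (bg9Y 𝔸 G) (fun x => (operatorLayerYOfLetters 𝔸 G x (𝔏 x) (𝔈 x)).Kdiff) OmK dOmega) :=
  Iff.rfl

end Thm314

/-! ## §2 Theorem 3.15 (row 24) through the (3.185) slot at the Sect. E layer over the class-parametric carrier -/

section Thm315

variable (R₁ R₂ : RegFamY d ℓ hd hL b₀ b₁ Mstar 𝔸)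

/-- the re-typed `Ck`-member of def-Y's Sect. E layer IS the index-bond kernel reading of `C^{(k)}(Λ; U) = CkY x 𝔏 𝔢` over `bg9YR R₁ R₂ x` (`rfl`).
[cite: Balaban1985BackgroundPropagators, Thm 3.15 (3.187) p.432 (bookkeeping: the kernel of C^{(k)}(Λ; U))] -/
theorem siteKernelR_Ck_operatorLayerYSectE (x : MemberY d ℓ hd hL b₀ b₁ Mstar) (ops : OperatorLayerY d ℓ hd hL b₀ b₁ Mstar 𝔸 G x)
    (𝔏 : CovLettersY 𝔸 x) (𝔢 : SectELettersY 𝔸 x) (𝔴 : RWLettersEY 𝔸 G x) :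
    siteKernelR R₁ R₂ (operatorLayerYSectE 𝔸 G x ops 𝔏 𝔢 𝔴).Ck =
      siteKernelOfOp x.toKIdx (bg9YR 𝔸 G R₁ R₂ x) (fun U => U) (CkY x 𝔏 𝔢) id id :=
  rfl

variable [FiniteDimensional ℂ 𝔸]

/-- ★★ **THEOREM 3.15 AS THE WHOLE PRINTED LEAF AT THE SECT. E LAYER OVER `bg9YR R₁ R₂`, THROUGH THE (3.185) SLOT, MIDDLE DECAY ON Λ ONLY**:
dag-n06-m's `B9Thm315WholeSectERepOn.thm315FullPrinted_sectE_of_3185_on` with `bg9Y ↦ bg9YR 𝔸 G R₁ R₂` — the class enters only as the two displayed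
premises `(bg9YR … x).Reg335 ∕ Reg336 c35Y α₀ U` (i.e. `R₁ ∕ R₂ x c35Y α₀ U`); the one-configuration step `bound3187_sectE_of_3185_on` is class-free.
OUTPUT δ₀ = δ₁, a₀, B₀ = B₁e^{2δ₁r}m_Em_F.  NOT a node discharge. [cite: Balaban1985BackgroundPropagators, Thm 3.15 (3.185)–(3.187) p.432, (3.169) p.430] -/
theorem thm315FullPrinted_sectE_of_3185_onR
    (ops : ∀ x : MemberY d ℓ hd hL b₀ b₁ Mstar, OperatorLayerY d ℓ hd hL b₀ b₁ Mstar 𝔸 G x)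
    (𝔏 : ∀ x : MemberY d ℓ hd hL b₀ b₁ Mstar, CovLettersY 𝔸 x) (𝔢 : ∀ x : MemberY d ℓ hd hL b₀ b₁ Mstar, SectELettersY 𝔸 x)
    (𝔴 : ∀ x : MemberY d ℓ hd hL b₀ b₁ Mstar, RWLettersEY 𝔸 G x)
    {a₀ δ₁ B₁ r mE mF : ℝ} (ha₀ : 0 < a₀) (hδ₁ : 0 < δ₁) (hB₁ : 0 < B₁) (hmE : 0 < mE) (hmF : 0 < mF)
    (h : ∀ (x : MemberY d ℓ hd hL b₀ b₁ Mstar) (α₀ : ℝ), 0 < α₀ → (geo9Y x).M * α₀ ≤ a₀ →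
      ∀ U : (bg9YR 𝔸 G R₁ R₂ x).Cfg, (bg9YR 𝔸 G R₁ R₂ x).Reg335 c35Y α₀ U → (bg9YR 𝔸 G R₁ R₂ x).Reg336 c35Y α₀ U →
        givenBy3185Y x (𝔏 x) (𝔢 x) U ∧ hasRWExpCY (𝔴 x) U δ₁ ∧
          LocalOuterY x (𝔢 x) r mE mF U ∧ DecayMidOnY x (𝔏 x) (𝔢 x) B₁ U δ₁) :
    B9.Thm315FullPrinted c35Y geo9Y (bg9YR 𝔸 G R₁ R₂)
      (fun x => siteKernelR R₁ R₂ (operatorLayerYSectE 𝔸 G x (ops x) (𝔏 x) (𝔢 x) (𝔴 x)).Ck) inΛY unitDistY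
      (fun x => (operatorLayerYSectE 𝔸 G x (ops x) (𝔏 x) (𝔢 x) (𝔴 x)).GivenBy3185)
      (fun x => (operatorLayerYSectE 𝔸 G x (ops x) (𝔏 x) (𝔢 x) (𝔴 x)).HasRWExpC) := by
  refine ⟨δ₁, a₀, B₁ * Real.exp (2 * δ₁ * r) * mE * mF, hδ₁, ha₀, by positivity, fun x α₀ hα hMa U hU hU' => ?_⟩
  obtain ⟨h85, hRW, hLoc, hS⟩ := h x α₀ hα hMa U hU hU'
  exact ⟨h85, hRW, fun y y' _ _ => bound3187_sectE_of_3185_on hB₁.le hδ₁.le h85 hLoc hS y y'⟩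

end Thm315

/-! ## §3 Record level (`G = SU(N)`): the edition-8 leaf `t315` at the Sect. E family `opsYSectE N θ M⋆ ops 𝔏 𝔢 𝔴` -/

section Record

open scoped Matrix.Norms.L2Operator

variable (N : ℕ) (θ : Stage3Params) (Mstar' : ℕ)
  (R₁ R₂ : RegFamY θ.d₆ θ.ℓ₆ θ.hd' θ.hL' θ.b₀ θ.b₁ Mstar' (Matrix (Fin N) (Fin N) ℂ))

/-- ★★★ **ROW 24 (`t315`) OVER THE CLASS-PARAMETRIC CARRIER AT THE SECT. E FAMILY `opsYSectE N θ M⋆ ops 𝔏 𝔢 𝔴`, THROUGH THE (3.185) SLOT, MIDDLE DECAY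
ON Λ ONLY** — LITERALLY the edition-8 leaf `t315` of `B9PinCarriersKLevelV1R.b9LeafX_carriersYR` at that family (edition 7's :254 call with `bg9Y ↦ bg9YR`):
dag-n06-m's `t315_opsYSectE_of_3185_on` re-pressed, the class as the displayed premises `(bg9YR … x).Reg335 ∕ Reg336 c35Y α₀ U`.
[cite: Balaban1985BackgroundPropagators, Thm 3.15 (3.185)–(3.187) p.432] -/
theorem t315_opsYSectE_of_3185_onR (ops : OpsY N θ Mstar') (𝔏 : LettersY N θ Mstar') (𝔢 : SectEY N θ Mstar') (𝔴 : RWEY N θ Mstar')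
    {a₀ δ₁ B₁ r mE mF : ℝ} (ha₀ : 0 < a₀) (hδ₁ : 0 < δ₁) (hB₁ : 0 < B₁) (hmE : 0 < mE) (hmF : 0 < mF)
    (h : ∀ (x : MemberY θ.d₆ θ.ℓ₆ θ.hd' θ.hL' θ.b₀ θ.b₁ Mstar') (α₀ : ℝ), 0 < α₀ → (geo9Y x).M * α₀ ≤ a₀ →
      ∀ U : (bg9YR (Matrix (Fin N) (Fin N) ℂ) (specialUnitaryUnits (Fin N)) R₁ R₂ x).Cfg,
        (bg9YR (Matrix (Fin N) (Fin N) ℂ) (specialUnitaryUnits (Fin N)) R₁ R₂ x).Reg335 c35Y α₀ U →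
        (bg9YR (Matrix (Fin N) (Fin N) ℂ) (specialUnitaryUnits (Fin N)) R₁ R₂ x).Reg336 c35Y α₀ U →
          givenBy3185Y x (𝔏 x) (𝔢 x) U ∧ hasRWExpCY (𝔴 x) U δ₁ ∧
            LocalOuterY x (𝔢 x) r mE mF U ∧ DecayMidOnY x (𝔏 x) (𝔢 x) B₁ U δ₁) :
    B9.Thm315FullPrinted c35Y geo9Y (bg9YR (Matrix (Fin N) (Fin N) ℂ) (specialUnitaryUnits (Fin N)) R₁ R₂)
      (fun x => siteKernelR R₁ R₂ (opsYSectE N θ Mstar' ops 𝔏 𝔢 𝔴 x).Ck) inΛY unitDistY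
      (fun x => (opsYSectE N θ Mstar' ops 𝔏 𝔢 𝔴 x).GivenBy3185) (fun x => (opsYSectE N θ Mstar' ops 𝔏 𝔢 𝔴 x).HasRWExpC) :=
  thm315FullPrinted_sectE_of_3185_onR R₁ R₂ ops 𝔏 𝔢 𝔴 ha₀ hδ₁ hB₁ hmE hmF h

/-- at MODULE 3's families `(regY335, regY336)` the re-pressed row 24 IS dag-n06-m's landed `t315_opsYSectE_of_3185_on`'s conclusion (def-Y's
`bg9Y_eq_bg9YR`, `rfl`). [cite: Balaban1985BackgroundPropagators, Thm 3.15 (3.187) p.432 (bookkeeping)] -/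
theorem t315_opsYSectE_of_3185_onR_regY_iff (ops : OpsY N θ Mstar') (𝔏 : LettersY N θ Mstar') (𝔢 : SectEY N θ Mstar')
    (𝔴 : RWEY N θ Mstar') :
    B9.Thm315FullPrinted c35Y geo9Y
        (bg9YR (Matrix (Fin N) (Fin N) ℂ) (specialUnitaryUnits (Fin N))
          (regY335 (Matrix (Fin N) (Fin N) ℂ) (specialUnitaryUnits (Fin N)))
          (regY336 (Matrix (Fin N) (Fin N) ℂ) (specialUnitaryUnits (Fin N))))
        (fun x => siteKernelR
          (regY335 (Matrix (Fin N) (Fin N) ℂ) (specialUnitaryUnits (Fin N)))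
          (regY336 (Matrix (Fin N) (Fin N) ℂ) (specialUnitaryUnits (Fin N)))
          (opsYSectE N θ Mstar' ops 𝔏 𝔢 𝔴 x).Ck) inΛY unitDistY
        (fun x => (opsYSectE N θ Mstar' ops 𝔏 𝔢 𝔴 x).GivenBy3185) (fun x => (opsYSectE N θ Mstar' ops 𝔏 𝔢 𝔴 x).HasRWExpC) ↔
      B9.Thm315FullPrinted c35Y geo9Y (bg9Y (Matrix (Fin N) (Fin N) ℂ) (specialUnitaryUnits (Fin N)))
        (fun x => (opsYSectE N θ Mstar' ops 𝔏 𝔢 𝔴 x).Ck) inΛY unitDistY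
        (fun x => (opsYSectE N θ Mstar' ops 𝔏 𝔢 𝔴 x).GivenBy3185) (fun x => (opsYSectE N θ Mstar' ops 𝔏 𝔢 𝔴 x).HasRWExpC) :=
  Iff.rfl

end Record

end Literature.MathematicalPhysics.QuantumFieldTheory.Balaban1983to89.B9Thm314Thm315LayerR

end
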